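import Summits.BirchSwinnertonDyer.BirchSwinnertonDyer.Theorems.ByReductionTypeAtTwoAdditivePotGoodLowerHalfT0NarrowRankLayerTwoResidueMap
import Summits.BirchSwinnertonDyer.BirchSwinnertonDyer.Theorems.ByReductionTypeAtTwoAdditivePotGoodLowerHalfT0NarrowRankLayerTwoTotPosSignsARow293200be1
import Summits.BirchSwinnertonDyer.BirchSwinnertonDyer.Theorems.ByReductionTypeAtTwoAdditivePotGoodLowerHalfT0NarrowRankLayerTwoTotPosSignsBRow293200be1
import HarnessLib

/-!
# K4 crux `AdditiveRankZeroAtTwo` (19098), children C3″ `AdditivePotGoodLowerHalfAtTwo` (22617) / C1″ (22615): census row `293200be1` — the displayed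
# hypothesis (hlow) `2^2 ≤ #(U⁺/U²)(A₂)` of the rung-`m = 2` stamp DISCHARGED IN THE KERNEL (`A₂ = ℚ(θ) ⊔ ℚ_2`, degree `12`,
# `θ³ + (-1)θ² + (-7)θ + (8) = 0`): two totally positive units, independent modulo unit squares
# (seat `bsd-2adic-k4-w2` GEN 16, key «HLOW-12»; `--supports stmt-BirchSwinnertonDyer-22617 --as helper`)

Cell `bsd-2adic`.  THEOREMS ONLY (no definition, no named fact, no `sorry`).  KERNEL chain: the generator units of `A₂` in TOWER COORDINATES
`b = θ`, `s = √2 = e² − 2`, `e = √(2+√2) ∈ ℚ_2` with exact inverse certificates (`…TotPosSignsBRow293200be1`; data GEN 15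
`k4w2/gen15/DATA-HLOW12-k4w2-GEN15.md`, eng-2 CERT-NARROW6-E2 v1.3 §6.1 (W) classes: `u1` = class of mask 1 (balanced2); `u2` = class of mask 2 (balanced2)); POSITIVITY at the twelve real places —
every `σ : A₂ → ℝ` restricts to one of the three located embeddings of `ℚ(θ)` (`card_realEmbeddings`) and maps `(s, e)` to `(±√2, ±√(2±√2))`, and on
each of the `12` sign patterns the generators are positive (`…TotPosSigns{A,B}Row293200be1`); NON-SQUARES — each of the `2^2 − 1` products reduces, under a residue map `𝓞_{A₂} → 𝔽_{113}` through
the order `ℤ[θ, e]` (GEN 16 `exists_ringHom_ringOfIntegers_sup_layer_two_zmod`, `113 ∤ 16·disc`), to a quadratic non-residue (`decide`), so it is not a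
unit square (`not_exists_eq_sq_of_map_not_isSquare`); the counting door `four_le_card_totPosUnitsModSq_of_ne_sq` (GEN 15) gives
★ `four_le_card_totPosUnitsModSq_sup_layer_two_disc733` = (hlow).  The re-stamp with (hsig) ALONE displayed is the sequel
`…NarrowRankSignBoundRow293200be1`.

HONEST FRAMING (D-0036 / D-0054 / D-0152): kernel arithmetic about one number field; closes nothing at the `∀`-level (C3″ 22617 / C1″ 22615
research-open); nothing booked; census tier of the row unchanged (CERT; displayed data `2 → 1` after the sequel); BSD is not proved by any of this.

References: [FrohlichTaylor1990] Ch. V §1 (1.10)–(1.13), pp. 163–164; [Cohen1993] §4.1.3, §6.3; [Washington1997] §13.1; [Marcus1977] Ch. 2 Ex. 41,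
Ch. 3 Thm. 27; [EdgarMollinPeterson1986] Thm. 2.1.
-/

set_option autoImplicit false
-- the Theorems namespace of this sub repeats the summit name by design (D-0017 nested layout)
set_option linter.dupNamespace false

noncomputable section

open scoped Classical IntermediateField NumberField Polynomial

namespace Summit.BirchSwinnertonDyer.BirchSwinnertonDyer.Theorems.AddKatoTwo

open Polynomial IsDedekindDomain NumberField Field IntermediateField
  Literature.NumberTheory.EllipticCurves Literature.NumberTheory.EllipticCurves.ZpExtension
  Literature.NumberTheory.IwasawaTheory Literature.NumberTheory.NumberFields
  Literature.NumberTheory.GaloisRepresentations Literature.Geometry.Kaehler.ComplexTorus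

variable {θ : AlgebraicClosure ℚ}


/-- Instance-free residue map (the primality of `ℓ` as a hypothesis; cf. `exists_ringHom_ringOfIntegers_sup_layer_two_zmod'`).
[cite: Marcus1977, Ch. 3 Thm. 27] -/
private theorem exists_ringHom_zmod_aux_disc733 {p q r : ℤ} (hirr : Irreducible (Cubic.toPoly ⟨1, (p : ℚ), q, r⟩))
    (hθ : aeval θ (Cubic.toPoly ⟨1, (p : ℚ), q, r⟩) = 0)
    (hreal : haveI : FiniteDimensional ℚ ↥ℚ⟮θ⟯ :=
        IntermediateField.adjoin.finiteDimensional ⟨_, Cubic.monic_of_a_eq_one', by rwa [← aeval_def]⟩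
      haveI : NumberField ↥ℚ⟮θ⟯ := NumberField.mk
      IsTotallyReal ↥ℚ⟮θ⟯)
    {e : AlgebraicClosure ℚ} (he : e ∈ (CyclotomicZp.zpExtension 2).layer 2) (he0 : (fun x : AlgebraicClosure ℚ => x ^ 2 - 2)^[2] e = 0)
    {ℓ : ℕ} (hℓp : ℓ.Prime) (hℓ : ((16 * Cubic.discr ⟨1, p, q, r⟩ : ℤ) : ZMod ℓ) ≠ 0)
    {x y : ZMod ℓ} (hx : x ^ 3 + (p : ZMod ℓ) * x ^ 2 + (q : ZMod ℓ) * x + (r : ZMod ℓ) = 0) (hy : y ^ 4 - 4 * y ^ 2 + 2 = 0) :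
    ∃ φ : 𝓞 ↥(ℚ⟮θ⟯ ⊔ (CyclotomicZp.zpExtension 2).layer 2) →+* ZMod ℓ,
      (∀ w : 𝓞 ↥(ℚ⟮θ⟯ ⊔ (CyclotomicZp.zpExtension 2).layer 2), (w : ↥(ℚ⟮θ⟯ ⊔ (CyclotomicZp.zpExtension 2).layer 2)) = inclusion (le_sup_left : ℚ⟮θ⟯ ≤ ℚ⟮θ⟯ ⊔ (CyclotomicZp.zpExtension 2).layer 2) (AdjoinSimple.gen ℚ θ) →
        φ w = x) ∧
      (∀ w : 𝓞 ↥(ℚ⟮θ⟯ ⊔ (CyclotomicZp.zpExtension 2).layer 2), (w : ↥(ℚ⟮θ⟯ ⊔ (CyclotomicZp.zpExtension 2).layer 2)) = (⟨e, (le_sup_right : (CyclotomicZp.zpExtension 2).layer 2 ≤ _) he⟩ : ↥(ℚ⟮θ⟯ ⊔ (CyclotomicZp.zpExtension 2).layer 2)) → φ w = y) := by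
  haveI : Fact ℓ.Prime := ⟨hℓp⟩
  exact exists_ringHom_ringOfIntegers_sup_layer_two_zmod hirr hθ hreal he he0 hℓ hx hy

set_option linter.unusedSimpArgs false in
set_option maxRecDepth 20000 in
set_option maxHeartbeats 6400000 in
set_option synthInstance.maxHeartbeats 400000 in
/-- ★ **(hlow) for `293200be1` IN THE KERNEL: `2^2 ≤ #(U⁺/U²)(A₂)`, `A₂ = ℚ(θ) ⊔ ℚ_2` (degree `12`), `θ³ + (-1)θ² + (-7)θ + (8) = 0`.**
Two explicit units of `A₂` in tower coordinates (GEN 15 DATA-HLOW12; eng-2 CERT-NARROW6-E2 v1.3 §6.1 (W) classes) are units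
(`layer_two_totpos_units_ids_disc733`), TOTALLY POSITIVE at the twelve real places (every `σ` restricts to one of the three located embeddings of
`ℚ(θ)` and sends `(s, e)` to `(±√2, ±√(2±√2))`; `layer_two_totpos_signs_*_disc733`), and none of their `2^2 − 1` products is a unit square (residue
maps `𝓞_{A₂} → 𝔽_ℓ` through the order `ℤ[θ, e]`, `exists_ringHom_ringOfIntegers_sup_layer_two_zmod`, `ℓ ∤ 16·disc`); the counting door
`four_le_card_totPosUnitsModSq_of_ne_sq`.  Discharges the displayed (hlow) of `conjA_two_293200be1_of_layerBounds₂₃''`.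
[cite: FrohlichTaylor1990, Ch. V §1 (1.10)–(1.12), pp. 163–164] [cite: Cohen1993, §4.1.3] [cite: Washington1997, §13.1] -/
theorem four_le_card_totPosUnitsModSq_sup_layer_two_disc733 (hθ : aeval θ (Cubic.toPoly ⟨1, ((-1 : ℤ) : ℚ), ((-7 : ℤ) : ℚ), ((8 : ℤ) : ℚ)⟩) = 0) :
    haveI : FiniteDimensional ℚ ↥ℚ⟮θ⟯ :=
      IntermediateField.adjoin.finiteDimensional ⟨_, Cubic.monic_of_a_eq_one', by rwa [← aeval_def]⟩
    haveI : FiniteDimensional ℚ ↥((CyclotomicZp.zpExtension 2).layer 2) := (CyclotomicZp.zpExtension 2).finiteDimensional_layer_holds 2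
    haveI : NumberField ↥(ℚ⟮θ⟯ ⊔ (CyclotomicZp.zpExtension 2).layer 2) := NumberField.mk
    2 ^ 2 ≤ Nat.card (TotPosUnitsModSq ↥(ℚ⟮θ⟯ ⊔ (CyclotomicZp.zpExtension 2).layer 2)) := by
  haveI : FiniteDimensional ℚ ↥ℚ⟮θ⟯ :=
    IntermediateField.adjoin.finiteDimensional ⟨_, Cubic.monic_of_a_eq_one', by rwa [← aeval_def]⟩
  haveI : FiniteDimensional ℚ ↥((CyclotomicZp.zpExtension 2).layer 2) := (CyclotomicZp.zpExtension 2).finiteDimensional_layer_holds 2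
  haveI : NumberField ↥ℚ⟮θ⟯ := NumberField.mk
  haveI : NumberField ↥(ℚ⟮θ⟯ ⊔ (CyclotomicZp.zpExtension 2).layer 2) := NumberField.mk
  haveI : Fact (Nat.Prime 2) := ⟨Nat.prime_two⟩
  obtain ⟨hreal2, hfin2, h3⟩ := layer_two_basics irreducible_cubic_disc_733 hθ (isTotallyReal_adjoin_disc733_lb hθ)
  haveI := hreal2
  haveI : IsTotallyReal ↥ℚ⟮θ⟯ := isTotallyReal_adjoin_disc733_lb hθ
  -- a root `e ∈ ℚ_2` of `Ψ₂` and the elements `θ'', s'' = e''² − 2, e''` of `A₂`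
  obtain ⟨e, he, -, he4⟩ := CyclotomicZp.exists_mem_layer_two_quartic_zpExtension
  have he0 : (fun x : AlgebraicClosure ℚ => x ^ 2 - 2)^[2] e = 0 := by
    simp only [Function.iterate_succ, Function.iterate_zero, Function.comp_apply, id_eq]
    linear_combination he4
  have hK2 : ℚ⟮θ⟯ ≤ ℚ⟮θ⟯ ⊔ (CyclotomicZp.zpExtension 2).layer 2 := le_sup_left
  have heA : e ∈ ℚ⟮θ⟯ ⊔ (CyclotomicZp.zpExtension 2).layer 2 := (le_sup_right : (CyclotomicZp.zpExtension 2).layer 2 ≤ _) he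
  set e'' : ↥(ℚ⟮θ⟯ ⊔ (CyclotomicZp.zpExtension 2).layer 2) := ⟨e, heA⟩ with he''def
  set θ'' : ↥(ℚ⟮θ⟯ ⊔ (CyclotomicZp.zpExtension 2).layer 2) := inclusion hK2 (AdjoinSimple.gen ℚ θ) with hθ''def
  set s'' : ↥(ℚ⟮θ⟯ ⊔ (CyclotomicZp.zpExtension 2).layer 2) := e'' ^ 2 - 2 with hs''def
  have hθrel : θ'' ^ 3 + (-1 : ↥(ℚ⟮θ⟯ ⊔ (CyclotomicZp.zpExtension 2).layer 2)) * θ'' ^ 2 + (-7 : ↥(ℚ⟮θ⟯ ⊔ (CyclotomicZp.zpExtension 2).layer 2)) * θ'' + (8 : ↥(ℚ⟮θ⟯ ⊔ (CyclotomicZp.zpExtension 2).layer 2)) = 0 := by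
    have h := hθ
    simp only [Cubic.toPoly, map_one, one_mul, aeval_add, aeval_mul, aeval_C, aeval_X_pow, aeval_X, eq_ratCast] at h
    push_cast at h
    apply (algebraMap ↥(ℚ⟮θ⟯ ⊔ (CyclotomicZp.zpExtension 2).layer 2) (AlgebraicClosure ℚ)).injective
    rw [hθ''def]
    simp only [map_add, map_mul, map_pow, map_neg, map_one, map_ofNat, map_zero, IntermediateField.algebraMap_apply,
      IntermediateField.coe_inclusion, AdjoinSimple.coe_gen]
    linear_combination h
  have he''4 : e'' ^ 4 - 4 * e'' ^ 2 + 2 = 0 := by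
    apply (algebraMap ↥(ℚ⟮θ⟯ ⊔ (CyclotomicZp.zpExtension 2).layer 2) (AlgebraicClosure ℚ)).injective
    rw [map_add, map_sub, map_mul, map_pow, map_pow, map_ofNat, map_ofNat, map_zero, IntermediateField.algebraMap_apply]
    exact he4
  have hsrel : s'' ^ 2 = 2 := by rw [hs''def]; linear_combination he''4
  have herel : e'' ^ 2 = 2 + s'' := by rw [hs''def]; ring
  -- integral versions
  have hθint : IsIntegral ℤ θ'' := by
    refine ⟨X ^ 3 + C (-1 : ℤ) * X ^ 2 + C (-7 : ℤ) * X + C (8 : ℤ), by monicity!, ?_⟩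
    simp only [eval₂_add, eval₂_mul, eval₂_pow, eval₂_C, eval₂_X]; simp only [eq_intCast]
    push_cast; linear_combination hθrel
  have heint : IsIntegral ℤ e'' := by
    refine ⟨X ^ 4 - C (4 : ℤ) * X ^ 2 + C (2 : ℤ), by monicity!, ?_⟩
    simp only [eval₂_add, eval₂_sub, eval₂_mul, eval₂_pow, eval₂_C, eval₂_X]; simp only [eq_intCast, Int.cast_ofNat]
    exact_mod_cast he''4
  set bE : 𝓞 ↥(ℚ⟮θ⟯ ⊔ (CyclotomicZp.zpExtension 2).layer 2) := ⟨θ'', hθint⟩ with hbEdef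
  set eE : 𝓞 ↥(ℚ⟮θ⟯ ⊔ (CyclotomicZp.zpExtension 2).layer 2) := ⟨e'', heint⟩ with heEdef
  set sE : 𝓞 ↥(ℚ⟮θ⟯ ⊔ (CyclotomicZp.zpExtension 2).layer 2) := eE ^ 2 - 2 with hsEdef
  have hbEval : ((bE : 𝓞 ↥(ℚ⟮θ⟯ ⊔ (CyclotomicZp.zpExtension 2).layer 2)) : ↥(ℚ⟮θ⟯ ⊔ (CyclotomicZp.zpExtension 2).layer 2)) = θ'' := rfl
  have heEval : ((eE : 𝓞 ↥(ℚ⟮θ⟯ ⊔ (CyclotomicZp.zpExtension 2).layer 2)) : ↥(ℚ⟮θ⟯ ⊔ (CyclotomicZp.zpExtension 2).layer 2)) = e'' := rfl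
  have hbE' : algebraMap (𝓞 ↥(ℚ⟮θ⟯ ⊔ (CyclotomicZp.zpExtension 2).layer 2)) ↥(ℚ⟮θ⟯ ⊔ (CyclotomicZp.zpExtension 2).layer 2) bE = θ'' := rfl
  have heE' : algebraMap (𝓞 ↥(ℚ⟮θ⟯ ⊔ (CyclotomicZp.zpExtension 2).layer 2)) ↥(ℚ⟮θ⟯ ⊔ (CyclotomicZp.zpExtension 2).layer 2) eE = e'' := rfl
  have hsE' : algebraMap (𝓞 ↥(ℚ⟮θ⟯ ⊔ (CyclotomicZp.zpExtension 2).layer 2)) ↥(ℚ⟮θ⟯ ⊔ (CyclotomicZp.zpExtension 2).layer 2) sE = s'' := by rw [hsEdef, map_sub, map_pow, heE', map_ofNat, hs''def]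
  have RbE : bE ^ 3 + (-1 : 𝓞 ↥(ℚ⟮θ⟯ ⊔ (CyclotomicZp.zpExtension 2).layer 2)) * bE ^ 2 + (-7 : 𝓞 ↥(ℚ⟮θ⟯ ⊔ (CyclotomicZp.zpExtension 2).layer 2)) * bE + (8 : 𝓞 ↥(ℚ⟮θ⟯ ⊔ (CyclotomicZp.zpExtension 2).layer 2)) = 0 := by
    apply NumberField.RingOfIntegers.coe_injective
    simp only [map_add, map_sub, map_mul, map_pow, map_neg, map_one, map_zero, map_ofNat, hbE']
    exact hθrel
  have RsE : sE ^ 2 = 2 := by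
    apply NumberField.RingOfIntegers.coe_injective
    rw [map_pow, hsE', map_ofNat]; exact hsrel
  have ReE : eE ^ 2 = 2 + sE := by rw [hsEdef]; ring
  obtain ⟨hid1, hid2⟩ := layer_two_totpos_units_ids_disc733 bE sE eE RbE RsE ReE
  set u1 : (𝓞 ↥(ℚ⟮θ⟯ ⊔ (CyclotomicZp.zpExtension 2).layer 2))ˣ := Units.mkOfMulEqOne _ _ hid1 with hu1def
  set u2 : (𝓞 ↥(ℚ⟮θ⟯ ⊔ (CyclotomicZp.zpExtension 2).layer 2))ˣ := Units.mkOfMulEqOne _ _ hid2 with hu2def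
  have hval1 : ((u1 : 𝓞 ↥(ℚ⟮θ⟯ ⊔ (CyclotomicZp.zpExtension 2).layer 2)) : ↥(ℚ⟮θ⟯ ⊔ (CyclotomicZp.zpExtension 2).layer 2)) = ((1 : ↥(ℚ⟮θ⟯ ⊔ (CyclotomicZp.zpExtension 2).layer 2)) + (-4 : ↥(ℚ⟮θ⟯ ⊔ (CyclotomicZp.zpExtension 2).layer 2)) * s'' + (-2 : ↥(ℚ⟮θ⟯ ⊔ (CyclotomicZp.zpExtension 2).layer 2)) * θ'' + (4 : ↥(ℚ⟮θ⟯ ⊔ (CyclotomicZp.zpExtension 2).layer 2)) * θ'' * s'' + (2 : ↥(ℚ⟮θ⟯ ⊔ (CyclotomicZp.zpExtension 2).layer 2)) * θ'' ^ 2) := by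
    rw [hu1def, Units.val_mkOfMulEqOne, NumberField.RingOfIntegers.coe_eq_algebraMap]
    simp only [map_add, map_sub, map_mul, map_pow, map_neg, map_one, map_zero, map_ofNat, hbE', hsE', heE']
  have hval2 : ((u2 : 𝓞 ↥(ℚ⟮θ⟯ ⊔ (CyclotomicZp.zpExtension 2).layer 2)) : ↥(ℚ⟮θ⟯ ⊔ (CyclotomicZp.zpExtension 2).layer 2)) = ((25 : ↥(ℚ⟮θ⟯ ⊔ (CyclotomicZp.zpExtension 2).layer 2)) + (-2 : ↥(ℚ⟮θ⟯ ⊔ (CyclotomicZp.zpExtension 2).layer 2)) * e'' + (-19 : ↥(ℚ⟮θ⟯ ⊔ (CyclotomicZp.zpExtension 2).layer 2)) * s'' + (2 : ↥(ℚ⟮θ⟯ ⊔ (CyclotomicZp.zpExtension 2).layer 2)) * s'' * e'' + (-12 : ↥(ℚ⟮θ⟯ ⊔ (CyclotomicZp.zpExtension 2).layer 2)) * θ'' + (28 : ↥(ℚ⟮θ⟯ ⊔ (CyclotomicZp.zpExtension 2).layer 2)) * θ'' * e'' + (9 : ↥(ℚ⟮θ⟯ ⊔ (CyclotomicZp.zpExtension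 2).layer 2)) * θ'' * s'' + (-20 : ↥(ℚ⟮θ⟯ ⊔ (CyclotomicZp.zpExtension 2).layer 2)) * θ'' * s'' * e'' + (5 : ↥(ℚ⟮θ⟯ ⊔ (CyclotomicZp.zpExtension 2).layer 2)) * θ'' ^ 2 + (-6 : ↥(ℚ⟮θ⟯ ⊔ (CyclotomicZp.zpExtension 2).layer 2)) * θ'' ^ 2 * e'' + (-3 : ↥(ℚ⟮θ⟯ ⊔ (CyclotomicZp.zpExtension 2).layer 2)) * θ'' ^ 2 * s'' + (4 : ↥(ℚ⟮θ⟯ ⊔ (CyclotomicZp.zpExtension 2).layer 2)) * θ'' ^ 2 * s'' * e'') := by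
    rw [hu2def, Units.val_mkOfMulEqOne, NumberField.RingOfIntegers.coe_eq_algebraMap]
    simp only [map_add, map_sub, map_mul, map_pow, map_neg, map_one, map_zero, map_ofNat, hbE', hsE', heE']
  -- every real place of `A₂`: `σ|ℚ(θ) ∈ {ρ₀, ρ₁, ρ₂}`, `σ(s'') = ±√2`, `σ(e'') = ±√(2 ± √2)`
  obtain ⟨ρ₀, ρ₁, ρ₂, x0, x1, x2, hρ₀, hρ₁, hρ₂, hl0, hu0, hl1, hu1, hl2, hu2⟩ := exists_three_ringHom_adjoin_hp_disc733 hθ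
  have hcardK : Fintype.card (↥ℚ⟮θ⟯ →+* ℝ) = 3 := by rw [card_realEmbeddings, h3]
  have hne : ∀ {φ ψ : ↥ℚ⟮θ⟯ →+* ℝ} {a c : ℝ}, φ (AdjoinSimple.gen ℚ θ) = a → ψ (AdjoinSimple.gen ℚ θ) = c → a ≠ c → φ ≠ ψ := by
    intro φ ψ a c ha hc hac h; rw [h] at ha; exact hac (ha.symm.trans hc)
  have h01 : ρ₀ ≠ ρ₁ := hne hρ₀ hρ₁ (by intro h; linarith)
  have h02 : ρ₀ ≠ ρ₂ := hne hρ₀ hρ₂ (by intro h; linarith)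
  have h12 : ρ₁ ≠ ρ₂ := hne hρ₁ hρ₂ (by intro h; linarith)
  have huniv : (Finset.univ : Finset (↥ℚ⟮θ⟯ →+* ℝ)) = {ρ₀, ρ₁, ρ₂} := by
    symm
    apply Finset.eq_of_subset_of_card_le (Finset.subset_univ _)
    rw [Finset.card_univ, hcardK, Finset.card_insert_of_notMem (by simp [h01, h02]), Finset.card_insert_of_notMem (by simp [h12]),
      Finset.card_singleton]
  have hsigns : ∀ σ : ↥(ℚ⟮θ⟯ ⊔ (CyclotomicZp.zpExtension 2).layer 2) →+* ℝ, 0 < σ ((1 : ↥(ℚ⟮θ⟯ ⊔ (CyclotomicZp.zpExtension 2).layer 2)) + (-4 : ↥(ℚ⟮θ⟯ ⊔ (CyclotomicZp.zpExtension 2).layer 2)) * s'' + (-2 : ↥(ℚ⟮θ⟯ ⊔ (CyclotomicZp.zpExtension 2).layer 2)) * θ'' + (4 : ↥(ℚ⟮θ⟯ ⊔ (CyclotomicZp.zpExtension 2).layer 2)) * θ'' * s'' + (2 : ↥(ℚ⟮θ⟯ ⊔ (CyclotomicZp.zpExtension 2).layer 2)) * θ'' ^ 2) ∧ 0 < σ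 ((25 : ↥(ℚ⟮θ⟯ ⊔ (CyclotomicZp.zpExtension 2).layer 2)) + (-2 : ↥(ℚ⟮θ⟯ ⊔ (CyclotomicZp.zpExtension 2).layer 2)) * e'' + (-19 : ↥(ℚ⟮θ⟯ ⊔ (CyclotomicZp.zpExtension 2).layer 2)) * s'' + (2 : ↥(ℚ⟮θ⟯ ⊔ (CyclotomicZp.zpExtension 2).layer 2)) * s'' * e'' + (-12 : ↥(ℚ⟮θ⟯ ⊔ (CyclotomicZp.zpExtension 2).layer 2)) * θ'' + (28 : ↥(ℚ⟮θ⟯ ⊔ (CyclotomicZp.zpExtension 2).layer 2)) * θ'' * e'' + (9 : ↥(ℚ⟮θ⟯ ⊔ (CyclotomicZp.zpExtension 2).layer 2)) * θ'' * s'' + (-20 : ↥(ℚ⟮θ⟯ ⊔ (CyclotomicZp.zpExtension 2).layer 2)) * θ'' * s'' * e'' + (5 : ↥(ℚ⟮θ⟯ ⊔ (CyclotomicZp.zpExtension 2).layer 2)) * θ'' ^ 2 + (-6 : ↥(ℚ⟮θ⟯ ⊔ (CyclotomicZp.zpExtension 2).layer 2)) * θ'' ^ 2 * e'' + (-3 :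 ↥(ℚ⟮θ⟯ ⊔ (CyclotomicZp.zpExtension 2).layer 2)) * θ'' ^ 2 * s'' + (4 : ↥(ℚ⟮θ⟯ ⊔ (CyclotomicZp.zpExtension 2).layer 2)) * θ'' ^ 2 * s'' * e'') := by
    intro σ
    -- `σ(θ'')` is a located root
    have hφ : σ.comp (inclusion hK2).toRingHom ∈ ({ρ₀, ρ₁, ρ₂} : Finset (↥ℚ⟮θ⟯ →+* ℝ)) := huniv ▸ Finset.mem_univ _
    simp only [Finset.mem_insert, Finset.mem_singleton] at hφ
    have hgen : ∀ {ρ : ↥ℚ⟮θ⟯ →+* ℝ} {x : ℝ}, σ.comp (inclusion hK2).toRingHom = ρ → ρ (AdjoinSimple.gen ℚ θ) = x → σ θ'' = x := by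
      intro ρ x hρ hx; rw [← hx, ← hρ]; rfl
    -- `σ(s'') = ±√2`, `σ(e'') = ±√(2 + σ(s''))`
    have hy2 : (σ s'') ^ 2 = 2 := by rw [← map_pow, hsrel, map_ofNat]
    have hy : σ s'' = Real.sqrt 2 ∨ σ s'' = -Real.sqrt 2 :=
      sq_eq_sq_iff_eq_or_eq_neg.mp (hy2.trans (Real.sq_sqrt (by norm_num : (0:ℝ) ≤ 2)).symm)
    have hz2 : (σ e'') ^ 2 = 2 + σ s'' := by rw [← map_pow, herel, map_add, map_ofNat]
    have hs2lt : Real.sqrt 2 < 2 := (Real.sqrt_lt' (by norm_num)).mpr (by norm_num)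
    have hzp : σ s'' = Real.sqrt 2 → σ e'' = Real.sqrt (2 + Real.sqrt 2) ∨ σ e'' = -Real.sqrt (2 + Real.sqrt 2) := by
      intro h; rw [h] at hz2
      exact sq_eq_sq_iff_eq_or_eq_neg.mp (hz2.trans (Real.sq_sqrt (by positivity)).symm)
    have hzm : σ s'' = -Real.sqrt 2 → σ e'' = Real.sqrt (2 - Real.sqrt 2) ∨ σ e'' = -Real.sqrt (2 - Real.sqrt 2) := by
      intro h; rw [h, ← sub_eq_add_neg] at hz2
      exact sq_eq_sq_iff_eq_or_eq_neg.mp (hz2.trans (Real.sq_sqrt (by linarith)).symm)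
    rcases hφ with hφ | hφ | hφ
    · have hx := hgen hφ hρ₀
      rcases hy with hs | hs
      · rcases hzp hs with hee | hee
        · exact layer_two_totpos_signs_r0_pp_disc733 σ θ'' s'' e'' x0 hx hs hee hl0 hu0
        · exact layer_two_totpos_signs_r0_pm_disc733 σ θ'' s'' e'' x0 hx hs hee hl0 hu0
      · rcases hzm hs with hee | hee
        · exact layer_two_totpos_signs_r0_mp_disc733 σ θ'' s'' e'' x0 hx hs hee hl0 hu0
        · exact layer_two_totpos_signs_r0_mm_disc733 σ θ'' s'' e'' x0 hx hs hee hl0 hu0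
    · have hx := hgen hφ hρ₁
      rcases hy with hs | hs
      · rcases hzp hs with hee | hee
        · exact layer_two_totpos_signs_r1_pp_disc733 σ θ'' s'' e'' x1 hx hs hee hl1 hu1
        · exact layer_two_totpos_signs_r1_pm_disc733 σ θ'' s'' e'' x1 hx hs hee hl1 hu1
      · rcases hzm hs with hee | hee
        · exact layer_two_totpos_signs_r1_mp_disc733 σ θ'' s'' e'' x1 hx hs hee hl1 hu1
        · exact layer_two_totpos_signs_r1_mm_disc733 σ θ'' s'' e'' x1 hx hs hee hl1 hu1
    · have hx := hgen hφ hρ₂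
      rcases hy with hs | hs
      · rcases hzp hs with hee | hee
        · exact layer_two_totpos_signs_r2_pp_disc733 σ θ'' s'' e'' x2 hx hs hee hl2 hu2
        · exact layer_two_totpos_signs_r2_pm_disc733 σ θ'' s'' e'' x2 hx hs hee hl2 hu2
      · rcases hzm hs with hee | hee
        · exact layer_two_totpos_signs_r2_mp_disc733 σ θ'' s'' e'' x2 hx hs hee hl2 hu2
        · exact layer_two_totpos_signs_r2_mm_disc733 σ θ'' s'' e'' x2 hx hs hee hl2 hu2
  have hpos1 : ∀ σ : ↥(ℚ⟮θ⟯ ⊔ (CyclotomicZp.zpExtension 2).layer 2) →+* ℝ, 0 < σ ((u1 : 𝓞 ↥(ℚ⟮θ⟯ ⊔ (CyclotomicZp.zpExtension 2).layer 2)) : ↥(ℚ⟮θ⟯ ⊔ (CyclotomicZp.zpExtension 2).layer 2)) := fun σ => by rw [hval1]; exact (hsigns σ).1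
  have hpos2 : ∀ σ : ↥(ℚ⟮θ⟯ ⊔ (CyclotomicZp.zpExtension 2).layer 2) →+* ℝ, 0 < σ ((u2 : 𝓞 ↥(ℚ⟮θ⟯ ⊔ (CyclotomicZp.zpExtension 2).layer 2)) : ↥(ℚ⟮θ⟯ ⊔ (CyclotomicZp.zpExtension 2).layer 2)) := fun σ => by rw [hval2]; exact (hsigns σ).2
  -- residue witnesses: none of the products is a unit square
  have hdisc : ((16 * Cubic.discr ⟨1, (-1 : ℤ), (-7 : ℤ), (8 : ℤ)⟩ : ℤ) : ZMod 113) ≠ 0 := by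
    simp only [Cubic.discr]; decide
  have h2 : ∀ w : (𝓞 ↥(ℚ⟮θ⟯ ⊔ (CyclotomicZp.zpExtension 2).layer 2))ˣ, u2 ≠ w ^ 2 := by
    obtain ⟨φ, hφb, hφe⟩ := exists_ringHom_zmod_aux_disc733 irreducible_cubic_disc_733 hθ (isTotallyReal_adjoin_disc733_lb hθ) he he0
      (by norm_num : Nat.Prime 113) hdisc (x := (60 : ZMod 113)) (y := (36 : ZMod 113)) (by decide) (by decide)
    have hb' : φ bE = 60 := hφb bE hbEval
    have he' : φ eE = 36 := hφe eE heEval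
    have hs' : φ sE = 36 ^ 2 - 2 := by rw [hsEdef, map_sub, map_pow, he', map_ofNat]
    have hv : φ ((u2 : (𝓞 ↥(ℚ⟮θ⟯ ⊔ (CyclotomicZp.zpExtension 2).layer 2))ˣ) : 𝓞 ↥(ℚ⟮θ⟯ ⊔ (CyclotomicZp.zpExtension 2).layer 2)) = (46 : ZMod 113) := by
      simp only [Units.val_mul, hu2def, Units.val_mkOfMulEqOne, map_mul, map_add, map_sub, map_pow, map_neg, map_one,
        map_ofNat, map_intCast, hb', he', hs']
      decide
    intro w hw
    exact not_exists_eq_sq_of_map_not_isSquare φ (u2) (by rw [hv]; decide) ⟨w, hw⟩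
  have h1 : ∀ w : (𝓞 ↥(ℚ⟮θ⟯ ⊔ (CyclotomicZp.zpExtension 2).layer 2))ˣ, u1 ≠ w ^ 2 := by
    obtain ⟨φ, hφb, hφe⟩ := exists_ringHom_zmod_aux_disc733 irreducible_cubic_disc_733 hθ (isTotallyReal_adjoin_disc733_lb hθ) he he0
      (by norm_num : Nat.Prime 113) hdisc (x := (60 : ZMod 113)) (y := (8 : ZMod 113)) (by decide) (by decide)
    have hb' : φ bE = 60 := hφb bE hbEval
    have he' : φ eE = 8 := hφe eE heEval
    have hs' : φ sE = 8 ^ 2 - 2 := by rw [hsEdef, map_sub, map_pow, he', map_ofNat]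
    have hv : φ ((u1 : (𝓞 ↥(ℚ⟮θ⟯ ⊔ (CyclotomicZp.zpExtension 2).layer 2))ˣ) : 𝓞 ↥(ℚ⟮θ⟯ ⊔ (CyclotomicZp.zpExtension 2).layer 2)) = (17 : ZMod 113) := by
      simp only [Units.val_mul, hu1def, Units.val_mkOfMulEqOne, map_mul, map_add, map_sub, map_pow, map_neg, map_one,
        map_ofNat, map_intCast, hb', he', hs']
      decide
    intro w hw
    exact not_exists_eq_sq_of_map_not_isSquare φ (u1) (by rw [hv]; decide) ⟨w, hw⟩
  have h12 : ∀ w : (𝓞 ↥(ℚ⟮θ⟯ ⊔ (CyclotomicZp.zpExtension 2).layer 2))ˣ, u1 * u2 ≠ w ^ 2 := by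
    obtain ⟨φ, hφb, hφe⟩ := exists_ringHom_zmod_aux_disc733 irreducible_cubic_disc_733 hθ (isTotallyReal_adjoin_disc733_lb hθ) he he0
      (by norm_num : Nat.Prime 113) hdisc (x := (60 : ZMod 113)) (y := (8 : ZMod 113)) (by decide) (by decide)
    have hb' : φ bE = 60 := hφb bE hbEval
    have he' : φ eE = 8 := hφe eE heEval
    have hs' : φ sE = 8 ^ 2 - 2 := by rw [hsEdef, map_sub, map_pow, he', map_ofNat]
    have hv : φ ((u1 * u2 : (𝓞 ↥(ℚ⟮θ⟯ ⊔ (CyclotomicZp.zpExtension 2).layer 2))ˣ) : 𝓞 ↥(ℚ⟮θ⟯ ⊔ (CyclotomicZp.zpExtension 2).layer 2)) = (3 : ZMod 113) := by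
      simp only [Units.val_mul, hu1def, hu2def, Units.val_mkOfMulEqOne, map_mul, map_add, map_sub, map_pow, map_neg, map_one,
        map_ofNat, map_intCast, hb', he', hs']
      decide
    intro w hw
    exact not_exists_eq_sq_of_map_not_isSquare φ (u1 * u2) (by rw [hv]; decide) ⟨w, hw⟩
  exact four_le_card_totPosUnitsModSq_of_ne_sq u1 u2 hpos1 hpos2 h1 h2 h12

end Summit.BirchSwinnertonDyer.BirchSwinnertonDyer.Theorems.AddKatoTwo

end
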